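import Summits.Ventures.PercRepro.C026DCSub
import Summits.Ventures.PercRepro.C026ClusterFlip

/-!
# (CF) holds on every marked multigraph with an edge `ca` (p5, gen 20; mine-3's class theorem, INBOX 9094)

mine-3 (note v34 §38 (h)): on a multigraph carrying an edge with ends `c` and `a`, the C-026 class slack
`Δ_CF = #ab|c + #ac|b + #bc|a − #N_AB` (`slackCF`, C026DCSub) is nonnegative. PROOF. The closed-cluster flip
at `b`, `Φ_b = kSwapInv b` (Lemma Φ, C026ClusterFlip), maps `N_AB = {a ~_ω b, c ≁_ω̄ a, c ≁_ω̄ b}` injectively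
into `ab|c ⊔ ac|b`: for `ω ∈ N_AB` the edge `e = ca` is red (a blue `ca` would join `c` and `a` in `ω̄`); after
the flip the red cluster of `b` is the closed cluster `D_b` of `b` (`conn_kSwapInv_iff`), which holds neither
`c` nor — in the second case — `a`. CASE `a ∈ D_b`: `a ~ b` and hence `a ≁ c` after the flip, so `Φ_b ω ∈ ab|c`.
CASE `a ∉ D_b`: `e` is not at `D_b`, stays red, so `c ~ a`, and `c ≁ b`: `Φ_b ω ∈ ac|b`. Injectivity is
`kSwap b ∘ kSwapInv b = id`. Hence `#N_AB ≤ #ab|c + #ac|b`.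

* **`slackCF_nonneg_of_edge`** — `0 ≤ slackCF a b c` whenever some edge of `G` has ends `c` and `a`.
Axioms: standard.
-/

namespace PercRepro

open Finset

namespace MultiGraph

section ClassEdge

variable {V E : Type*} {G : MultiGraph V E}

/-- An open edge with ends `c` and `a` (in either order) connects `c` to `a`. -/
theorem conn_of_open_of_ends {ω : Config E} {a c : V} {e : E} (hopen : ω e = true)
    (he : (G.fst e = c ∧ G.snd e = a) ∨ (G.fst e = a ∧ G.snd e = c)) : G.Conn ω c a := by
  have h := Conn.of_openAdj (G.openAdj_of_open e hopen)
  rcases he with ⟨h1, h2⟩ | ⟨h1, h2⟩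
  · rw [h1, h2] at h
    exact h
  · rw [h1, h2] at h
    exact h.symm

/-- **The closed-cluster flip at `b` sends `N_AB` into `ab|c ⊔ ac|b`** when `e = ca` is an edge of `G` (the
hypothesis `a ~_ω b` of `N_AB` is not even needed). -/
theorem kSwapInv_mem_of_edge {ω : Config E} {a b c : V} {e : E}
    (he : (G.fst e = c ∧ G.snd e = a) ∨ (G.fst e = a ∧ G.snd e = c))
    (hca : ¬ G.Conn ωᶜ c a) (hcb : ¬ G.Conn ωᶜ c b) :
    (G.Conn (G.kSwapInv b ω) a b ∧ ¬ G.Conn (G.kSwapInv b ω) a c) ∨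
      (G.Conn (G.kSwapInv b ω) c a ∧ ¬ G.Conn (G.kSwapInv b ω) c b) := by
  -- after the flip, `c` is not in the red cluster of `b`
  have hbc' : ¬ G.Conn (G.kSwapInv b ω) b c := by
    rw [conn_kSwapInv_iff]
    exact fun h => hcb h.symm
  by_cases hba : G.Conn ωᶜ b a
  · -- `a` lies in the closed cluster of `b`: after the flip `a ~ b`, hence `a ≁ c`
    left
    have h1 : G.Conn (G.kSwapInv b ω) b a := (conn_kSwapInv_iff b a ω).2 hba
    exact ⟨h1.symm, fun hac => hbc' (h1.trans hac)⟩
  · -- `a` is outside the closed cluster of `b`: the edge `ca` is red and stays red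
    right
    have hopen : ω e = true := by
      by_contra hne
      have h0 : ω e = false := by simpa using hne
      have hc : ωᶜ e = true := by
        rw [compl_apply_not, h0]
        rfl
      exact hca (conn_of_open_of_ends hc he)
    have hnot : e ∉ G.edgesAt (G.cluster ωᶜ b) := by
      rw [mem_edgesAt]
      simp only [mem_cluster]
      rcases he with ⟨h1, h2⟩ | ⟨h1, h2⟩
      · rw [h1, h2]
        rintro (h | h)
        · exact hcb h.symm
        · exact hba h
      · rw [h1, h2]
        rintro (h | h)
        · exact hba h
        · exact hcb h.symm
    have hopen' : G.kSwapInv b ω e = true := by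
      rw [kSwapInv_apply_of_notMem hnot]
      exact hopen
    exact ⟨conn_of_open_of_ends hopen' he, fun h => hbc' h.symm⟩

open Classical in
/-- **(CF) on a multigraph with an edge `ca`** (mine-3, note v34 §38 (h)): `#N_AB ≤ #ab|c + #ac|b` by the
injection `kSwapInv b`, hence `0 ≤ Δ_CF`. -/
theorem slackCF_nonneg_of_edge [Fintype E] {a b c : V} (e : E)
    (he : (G.fst e = c ∧ G.snd e = a) ∨ (G.fst e = a ∧ G.snd e = c)) :
    0 ≤ G.slackCF a b c := by
  have key : (univ.filter fun ω : Config E =>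
      G.Conn ω a b ∧ ¬ G.Conn ωᶜ c a ∧ ¬ G.Conn ωᶜ c b).card ≤
      (univ.filter fun ω : Config E =>
        (G.Conn ω a b ∧ ¬ G.Conn ω a c) ∨ (G.Conn ω c a ∧ ¬ G.Conn ω c b)).card := by
    refine Finset.card_le_card_of_injOn (G.kSwapInv b) ?_ ?_
    · intro ω hω
      simp only [Finset.coe_filter, Finset.mem_univ, true_and, Set.mem_setOf_eq] at hω ⊢
      exact kSwapInv_mem_of_edge he hω.2.1 hω.2.2
    · intro ω _ τ _ h
      have h' := congrArg (G.kSwap b) h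
      rwa [kSwap_kSwapInv, kSwap_kSwapInv] at h'
  rw [Finset.filter_or, Finset.card_union_of_disjoint] at key
  · unfold slackCF
    omega
  · rw [Finset.disjoint_filter]
    intro ω _ h1 h2
    exact h1.2 h2.1.symm

end ClassEdge

end MultiGraph

end PercRepro
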